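import Summits.SmoothPoincare4.SmoothPoincare4.Theorems.SymplecticOrigamiOrigamiFoldExistenceShadowPleatsDefs
import Literature.Topology.Immersions.WrinkledEmbeddingsRoundCollar
import Literature.Topology.FourManifolds.HomotopyS4CompactProofs

/-!
# Stub `stub_roundRimNormalForm` of line `shadow-pleats` for crux `OrigamiFoldExistence`:
# conditional discharge
(item stmt-SmoothPoincare4-7844, route route-SmoothPoincare4-SymplecticOrigami,
line `shadow-pleats`, stub `stub_roundRimNormalForm` = S2 "round-rim normal form",
Eliashberg–Mishachev)

The registered stub `stub_roundRimNormalForm` says: a smooth `4`-manifold `M` homotopy equivalent to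
`S⁴` which embeds smoothly in `ℝ⁵` admits a PLEATED ROUND-RIM SHADOW POSITION with some number `k`
of pleat charts (`∃ k, HasPleatedPosition M k`, vocabulary of
`…Theorems.SymplecticOrigamiOrigamiFoldExistenceShadowPleatsDefs`).  It is an h-principle and is not
proved unconditionally in the tree.  This file proves it CONDITIONALLY on the three named facts of
`Literature.Topology.Immersions.WrinkledEmbeddingsRoundCollar` (landed p98391 for exactly this
glue):

* (F1)
  `Literature.Topology.Immersions.EliashbergMishachev2009_doubleFolds_of_hasTransversalRotation`
  — Eliashberg–Mishachev, *Wrinkled embeddings* (2009), Thm. 3.2 in its double-fold, relative,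
  `C⁰`-small form, for a closed hypersurface of `ℝ⁵` with round lower part and the vertical line
  foliation: eight-clause packaged conclusion (new embedding `ι`, `k` double-fold charts `e`);
* (F2) `Literature.Topology.Immersions.exists_isSmoothEmbedding_roundPart` — Kosinski Ch. VI: a
  closed nonempty `4`-manifold embedded in `ℝ⁵` re-embeds with ROUND LOWER PART up to any level
  `1 - δ₁`, `0 < δ₁ < 1`;
* (F3) `Literature.Topology.Immersions.hasTransversalRotation_of_homotopyEquiv_sphere_four` —
  Guillemin–Pollack Ch. 4 §9 / Hopf: on a homotopy `4`-sphere with round lower part the formal datum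
  `HasTransversalRotation ι₁ δ₁ δ` holds.

GLUE (`stub_roundRimNormalForm_of_facts`): from `hM : M ≃ₕ S⁴` get `CompactSpace M`
(`Literature.Topology.FourManifolds.compactSpace_of_homotopyEquiv_sphere_four_holds`, PROVED) and
`Nonempty M` (the image of a point of `S⁴` under `hM.symm`); with `δ₁ = 1/4`, `δ = 1/2`, `ε = 1`,
(F2) gives `ι₁`, (F3) the datum, (F1) the triple `(ι, k, e)`; the eight clauses of (F1) are then
re-assembled into `IsPleatedPosition ι (1/2) e`.  The round clause at level `1 - 1/2` follows from
clauses 3–4 of (F1) and the round clause of `ι₁` at level `1 - 1/4` by set algebra; the last three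
clauses are transported along the DEFINITIONAL identifications `shadowProj = proj5`,
`doubleFoldSpheres = pleatSpheres`, `IsWhitneyFoldAt = IsFoldPointAt` (byte-identical bodies on the
Literature side and in the line vocabulary; `rfl`).

No decl here is named `stub_roundRimNormalForm`: the lead wires `stub_roundRimNormalForm_of_facts`
into the skeleton.  No new objects are posited; nothing about pleat numbers is claimed.
-/

noncomputable section

-- the prescribed namespace `Summit.<P>.<Sub>.…` duplicates `SmoothPoincare4` (P = Sub)
set_option linter.dupNamespace false

open scoped Manifold ContDiff Topology ContinuousMap
open Set Function

namespace Summit.SmoothPoincare4.SmoothPoincare4.Theorems.OrigamiFoldExistence.ShadowPleats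

/-! ### The three definitional identifications Literature-side ↔ line vocabulary -/

/-- The Literature-side vertical shadow `shadowProj` IS the line's `proj5` (identical bodies). -/
theorem shadowProj_eq_proj5 : Literature.Topology.Immersions.shadowProj = proj5 := rfl

/-- The Literature-side `doubleFoldSpheres` IS the line's `pleatSpheres` (identical bodies: the
round spheres of radii `1` and `2` of the chart `ℝ⁴`). -/
theorem doubleFoldSpheres_eq_pleatSpheres :
    Literature.Topology.Immersions.doubleFoldSpheres = pleatSpheres := rfl

/-- The Literature-side Whitney fold predicate `IsWhitneyFoldAt` IS the line's `IsFoldPointAt`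
(identical bodies). -/
theorem isWhitneyFoldAt_eq_isFoldPointAt :
    Literature.Topology.Immersions.IsWhitneyFoldAt = IsFoldPointAt := rfl

/-! ### Set algebra of the round clause -/

/-- ROUND CLAUSE TRANSFER.  If `ι₁` has round lower part up to the level `1 - δ₁`, `ι` agrees with
`ι₁` wherever `h ∘ ι₁ ≤ 1 - δ` and keeps the rest of `M` strictly above the plane `h = 1 - δ`, and
`δ₁ ≤ δ`, then `ι` has round lower part up to the level `1 - δ`. [folklore] -/
theorem roundPart_of_eqOn_below {M : Type*} {ι ι₁ : M → EuclideanSpace ℝ (Fin 5)} {δ₁ δ : ℝ}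
    (hδ : δ₁ ≤ δ)
    (hround : Set.range ι₁ ∩ {p : EuclideanSpace ℝ (Fin 5) | p 4 ≤ 1 - δ₁} =
      (Metric.sphere (0 : EuclideanSpace ℝ (Fin 5)) 1 : Set (EuclideanSpace ℝ (Fin 5))) ∩
        {p : EuclideanSpace ℝ (Fin 5) | p 4 ≤ 1 - δ₁})
    (hbelow : ∀ m : M, ι₁ m 4 ≤ 1 - δ → ι m = ι₁ m)
    (habove : ∀ m : M, 1 - δ < ι₁ m 4 → 1 - δ < ι m 4) :
    Set.range ι ∩ {p : EuclideanSpace ℝ (Fin 5) | p 4 ≤ 1 - δ} =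
      (Metric.sphere (0 : EuclideanSpace ℝ (Fin 5)) 1 : Set (EuclideanSpace ℝ (Fin 5))) ∩
        {p : EuclideanSpace ℝ (Fin 5) | p 4 ≤ 1 - δ} := by
  ext p
  simp only [Set.mem_inter_iff, Set.mem_range, Set.mem_setOf_eq]
  constructor
  · rintro ⟨⟨m, rfl⟩, hp⟩
    -- `m` lies at `ι₁`-height `≤ 1 - δ` (else `ι m` would be above the plane), so `ι m = ι₁ m`
    have hm : ι₁ m 4 ≤ 1 - δ := by
      by_contra h
      exact absurd hp (not_le.mpr (habove m (not_le.mp h)))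
    have he : ι m = ι₁ m := hbelow m hm
    refine ⟨?_, hp⟩
    have hmem : ι₁ m ∈ Set.range ι₁ ∩ {p : EuclideanSpace ℝ (Fin 5) | p 4 ≤ 1 - δ₁} :=
      ⟨Set.mem_range_self m, by simp only [Set.mem_setOf_eq]; linarith⟩
    rw [hround] at hmem
    rw [he]
    exact hmem.1
  · rintro ⟨hs, hp⟩
    have hmem : p ∈
        (Metric.sphere (0 : EuclideanSpace ℝ (Fin 5)) 1 : Set (EuclideanSpace ℝ (Fin 5))) ∩
          {p : EuclideanSpace ℝ (Fin 5) | p 4 ≤ 1 - δ₁} :=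
      ⟨hs, by simp only [Set.mem_setOf_eq]; linarith⟩
    rw [← hround] at hmem
    obtain ⟨⟨m, rfl⟩, -⟩ := hmem
    exact ⟨⟨m, hbelow m hp⟩, hp⟩

/-! ### The conditional discharge of `stub_roundRimNormalForm` -/

/-- **Round-rim normal form, CONDITIONAL on (F1)–(F3)** (the registered stub
`stub_roundRimNormalForm` of line `shadow-pleats`, with the three named facts of
`Literature.Topology.Immersions.WrinkledEmbeddingsRoundCollar` as hypotheses; the conclusion is
textually the registered signature).  A smooth `4`-manifold homotopy equivalent to `S⁴` which embeds
smoothly in `ℝ⁵` has a pleated round-rim shadow position with some number of pleat charts: make the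
lower part round (F2, using compactness from `M ≃ₕ S⁴` and nonemptiness from `S⁴ ≠ ∅`), obtain the
formal datum (F3), apply Eliashberg–Mishachev (F1) with `δ₁ = 1/4`, `δ = 1/2`, `ε = 1`, and
re-assemble its eight clauses into `IsPleatedPosition ι (1/2) e`. -/
theorem stub_roundRimNormalForm_of_facts
    (hEM :
      Literature.Topology.Immersions.EliashbergMishachev2009_doubleFolds_of_hasTransversalRotation)
    (hRP : Literature.Topology.Immersions.exists_isSmoothEmbedding_roundPart)
    (hTR : Literature.Topology.Immersions.hasTransversalRotation_of_homotopyEquiv_sphere_four) :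
    ∀ (M : Type) [TopologicalSpace M] [T2Space M] [SecondCountableTopology M]
      [ChartedSpace (EuclideanSpace ℝ (Fin 4)) M] [IsManifold (𝓡 4) ∞ M]
      (ι₀ : M → EuclideanSpace ℝ (Fin 5)),
      M ≃ₕ (Metric.sphere (0 : EuclideanSpace ℝ (Fin 5)) 1) →
      Manifold.IsSmoothEmbedding (𝓡 4) (𝓡 5) ∞ ι₀ → ∃ k, HasPleatedPosition M k := by
  intro M _ _ _ _ _ ι₀ hM hι₀
  -- packaging: a homotopy `4`-sphere is compact (PROVED named fact) and nonempty (image of a point)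
  haveI : CompactSpace M :=
    Literature.Topology.FourManifolds.compactSpace_of_homotopyEquiv_sphere_four_holds M hM
  haveI : Nonempty (Metric.sphere (0 : EuclideanSpace ℝ (Fin 5)) 1) :=
    (NormedSpace.sphere_nonempty.mpr zero_le_one).to_subtype
  haveI : Nonempty M := Nonempty.map hM.symm inferInstance
  -- (F2): round lower part up to the level `1 - 1/4`
  obtain ⟨ι₁, hι₁, hround₁⟩ := hRP M ι₀ hι₀ (1 / 4) (by norm_num) (by norm_num)
  -- (F3): the formal datum for `δ₁ = 1/4`, `δ = 1/2`
  have hdatum : Literature.Topology.Immersions.HasTransversalRotation ι₁ (1 / 4) (1 / 2) :=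
    hTR M ι₁ (1 / 4) (1 / 2) hM hι₁ (by norm_num) (by norm_num) (by norm_num) hround₁
  -- (F1): Eliashberg–Mishachev with `ε = 1`
  obtain ⟨ι, k, e, hemb, -, hbelow, habove, hcharts, hdisj, himm, hfold⟩ :=
    hEM M ι₁ (1 / 4) (1 / 2) hι₁ (by norm_num) (by norm_num) (by norm_num) hround₁ hdatum 1 one_pos
  -- re-assemble `IsPleatedPosition ι (1/2) e`
  refine ⟨k, ι, 1 / 2, e, hemb, by norm_num, by norm_num, ?_, hcharts, ?_, ?_, ?_⟩
  · exact roundPart_of_eqOn_below (by norm_num) hround₁ hbelow habove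
  · -- clauses 6–8 of (F1), transported along the three definitional identifications
    rw [← doubleFoldSpheres_eq_pleatSpheres]
    exact hdisj
  · rw [← doubleFoldSpheres_eq_pleatSpheres, ← shadowProj_eq_proj5]
    exact himm
  · rw [← doubleFoldSpheres_eq_pleatSpheres, ← shadowProj_eq_proj5,
      ← isWhitneyFoldAt_eq_isFoldPointAt]
    exact hfold

end Summit.SmoothPoincare4.SmoothPoincare4.Theorems.OrigamiFoldExistence.ShadowPleats

end
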